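import Summits.QuantumFields.BalabanUV.T4Continuum.Support.NE3EnergyRateWSupOfSlicePoincare
import Summits.QuantumFields.BalabanUV.T4Continuum.Support.NE3EndpointResponse
import HarnessLib

/-!
# T⁴ programme, node NE3 — THE ENDPOINT CHART: the chart's leaves WITHOUT a path in the fibre (minimality at the two ends
# only), with a reference tangent direction and a residual deviation of quadratic size; the END in any norm and the weighted
# END at one pair

NE3 (node U1b), row NE3 OWNER `b2b-balaban-t4-ne3-p1` (gen 24); design note `HOME/t4/b2b-balaban-t4-ne3-p1/g24/D-ne3p1-g24-1.md`
(ruling ρ-g24-2, route Π), over Π-E `NE3EndpointResponse`.  `NE3EnergyChartLeaves.ChartLeaves` ∕ the junction's `ChartPath` carry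
the field `adm : ∀ t ∈ [0,1], W·e^{Γ t} ∈ admissible 𝒞 L k V` — the path must run INSIDE the non-linear fibre of the k-fold average
(B11 Prop. 3's linearising transformation).  The endpoint form of the response (`NE3EndpointResponse.energyResponse_of_endpointData`)
needs admissibility at `t = 1` ONLY (`W ∈ admissible`, KERNEL for `W = cavg L U_B`), and tolerates (i) a REFERENCE direction
`Xref ∈ T` in place of the exact tangent datum `Ψ 1` (so a small gauge ∕ normal deviation `Ψ 1 − Xref` is allowed) and (ii) a
quadratic slack `q` in the first variation at `W` against that deviation.

CONTENT ([folklore]; ONE hypothesis structure, 0 sorry):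
* §1 `EndpointChart 𝒞 L N k V U_A U_B u Γ Ψ Ψ′ Xref T Nrm θ κ θ₀ q a` — `ChartLeaves` with `adm` ↦ `admW : cavg L U_B ∈ admissible 𝒞 L k V`,
  `tangent : Ψ 1 ∈ T` ↦ `refT : Xref ∈ T` + `velocity : Nrm (Ψ t − Xref) ≤ θ·Nrm Xref` + `resDev : dAction W (Ψ 1) ≤ dAction W Xref + q·Nrm Xref²`,
  `close`∕`accel` measured against `Xref`, and no `coer` (supplied as a clause, as in the junction); `endpointChart_of_chartPath`
  (a `coer`-free fibre chart IS an endpoint chart with `Xref := Ψ 1`, `q := 0`);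
* §2 `EndpointChart.end_le` — `A(W·e^{Γ 0}) ≤ A(W·e^{Γ 1})` from `IsMinimiser … U_A`, `rep`, `admW`, `endW` (gauge invariance
  `fineAction_gaugeAct`);
* §3 **`norm_le_of_endpointChart`** — THE END IN ANY NORM: endpoint chart + a `coer` clause on `T` along the path + Λ-continuity
  + the residual binder at `W` for `Xref` + budget `2Λθ + Λθ² + κ + 2q ≤ c∕2` ⟹ **`Nrm (Γ 0) ≤ (1+θ₀)·(4r∕c)`**;
* §4 `EndpointChart.of_eqOn_periodic`; §5 **`energyNormW_le_of_endpointChart`** — THE WEIGHTED END AT ONE PAIR in the owner's sockets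
  (`cont_weighted`, (RES♯) `CurlPairedResidual … T r`, `coer` clause in `energyNormW`): `energyNormW L k W (Γ 0) F ≤ (1+θ₀)·(4r∕c)`.

HONEST FRAMING.  Kernel bookkeeping; `EndpointChart` is a hypothesis SHAPE asserted for no configuration of Bałaban's; (P♮)_W,
T-E_w♯, NE3 NOT proved; spine PROVED 0∕9; finite T⁴ rung (B)+1 — NOT infinite volume, NOT mass gap, NOT `BetaPertH`, NOT Clay.
ABSOLUTE RULE kept (context only: [Balaban1985Variational] Prop. 2∕3 pp. 281∕289).  PLACEMENT: `Summits/QuantumFields/BalabanUV/`.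
HONEST DEPENDENCY: continuum YM on T⁴ ⇐ BetaPertH ∧ nine spine estimates (0/9 proved); BetaPertH ⇐ (D1) ∧ (D4) ∧ CAP+tail;
G-an2-4 gates asym, D1 and NE2/3/4.
-/

set_option autoImplicit false

open scoped BigOperators Matrix.Norms.L2Operator
open NormedSpace Finset

namespace Summit.QuantumFields.BalabanUV.T4Continuum.NE3EndpointChart

open Set
open Literature.MathematicalPhysics.QuantumFieldTheory.Balaban1983to89
open B7Prop1Explicit B7Prop2Explicit
open T4AveragingDeficitWall hiding Site Plane Plaq Bond
open T4AveragingDeficitWallBoundary (periodBox)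
open AveragingDeficitPeriodicCounting (IsPeriodicDir)
open AveragingDeficitChartCalculus (cavg)
open AveragingDeficitPlaqDeriv (vary_isUnitaryCfg)
open MinimalActionLevels (perWin levelAction stepWt stepWt_pos)
open MinimalActionSandwich (IsMinimiser admissible)
open NE3EnergyShapes (IsUnitarySite IsPeriodicSite)
open NE3HessForm (dAction hess hasDerivAt_fineAction_vary_at)
open NE3EnergyHessCont (HsPer HsPer_symm HsPer_self_of_periodic abs_e_le perExt perExt_eq_of_periodic)
open NE3EnergyPathC2 (hasDerivAt_fineAction_gpath hasDerivAt_dAction_gpath)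
open NE3EnergyAssembly (fineAction_gaugeAct)
open NE3EnergyChartLeaves (isPeriodicDir_vel)
open NE3EnergyChartLeavesWeighted (cont_weighted)
open NE3EnergyChartLeavesSockets (energyNormW_eq_sqrt_div res_of_curlPairedResidual)
open NE3EnergyWeightedShapes (energyNormW energyNormW_nonneg CurlPairedResidual)
open NE3EnergyRateWSupOfSlicePoincare (ChartPath)
open NE3EndpointResponse (energyResponse_of_endpointData_budget)

noncomputable section

variable {d : ℕ} {n : Type*} [Fintype n] [DecidableEq n]

/-! ## §1 The endpoint chart at one pair -/

/-- **THE ENDPOINT CHART AT ONE PAIR** `(U_A, U_B)` (background `W := cavg L U_B`, period `N·L^k`, window `perWin d (N·L^k)`):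
L1 REP (`gauge`, `rep`); a bondwise-C² path of skew periodic directions from `Γ 0` to `Γ 1 = 0` with velocities `Ψ`, accelerations `Ψ′`
(`endW skew per vel acc skewAcc`); admissibility of the END configuration `W` only (`admW`); a REFERENCE tangent direction `Xref ∈ T`
(`refT`, `perT`) against which the velocity deviation (`velocity`, θ), the start (`close`, θ₀), the residual deviation at `W` (`resDev`, q)
and the acceleration (`accel`, κ, with the plaquette radius `a` of `small`) are measured in the norm `Nrm`.  A hypothesis SHAPE. [folklore] -/
@[folklore]
structure EndpointChart (𝒞 : ℕ → Set (Site d → Fin d → (Matrix n n ℂ)ˣ)) (L N k : ℕ)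
    (V UA UB : Site d → Fin d → (Matrix n n ℂ)ˣ) (u : Site d → (Matrix n n ℂ)ˣ)
    (Γ Ψ Ψ' : ℝ → Site d → Fin d → Matrix n n ℂ) (Xref : Site d → Fin d → Matrix n n ℂ) (T : Set (Site d → Fin d → Matrix n n ℂ))
    (Nrm : (Site d → Fin d → Matrix n n ℂ) → ℝ) (θ κ θ₀ q a : ℝ) : Prop where
  /-- L1 REP: the gauge transformation is `U(N)`-valued and periodic -/
  gauge : IsUnitarySite u ∧ IsPeriodicSite u ((N * L ^ k : ℕ) : ℤ)
  /-- L1 REP: `U_A^u = W·exp Γ(0)` -/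
  rep : gaugeAct u UA = vary (cavg L UB) (Γ 0) 1
  /-- the path ends at the background: `Γ 1 = 0` -/
  endW : Γ 1 = 0
  /-- the path fields are `𝔲(N)`-valued at all times -/
  skew : ∀ t, IsSkewDir (Γ t)
  /-- the path fields are periodic at all times -/
  per : ∀ t, IsPeriodicDir (Γ t) ((N * L ^ k : ℕ) : ℤ)
  /-- `Ψ t` is the bondwise right-logarithmic velocity of the path on `[0,1]` -/
  vel : ∀ t ∈ Icc (0:ℝ) 1, ∀ (y : Site d) (μ : Fin d),
    HasDerivAt (fun s => exp (Γ s y μ)) (exp (Γ t y μ) * Ψ t y μ) t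
  /-- `Ψ′ t` is the bondwise derivative of the velocity on `[0,1]` -/
  acc : ∀ t ∈ Icc (0:ℝ) 1, ∀ (y : Site d) (μ : Fin d), HasDerivAt (fun s => Ψ s y μ) (Ψ' t y μ) t
  /-- the accelerations are `𝔲(N)`-valued on `[0,1]` -/
  skewAcc : ∀ t ∈ Icc (0:ℝ) 1, IsSkewDir (Ψ' t)
  /-- ADMISSIBILITY AT THE END ONLY: the background `W = cavg L U_B` is admissible for run A -/
  admW : cavg L UB ∈ admissible 𝒞 L k V
  /-- the reference direction lies in the tangent space -/
  refT : Xref ∈ T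
  /-- the tangent space consists of periodic directions -/
  perT : ∀ Y ∈ T, IsPeriodicDir Y ((N * L ^ k : ℕ) : ℤ)
  /-- the velocity stays `θ`-close to the reference direction in the norm `Nrm` -/
  velocity : ∀ t ∈ Icc (0:ℝ) 1, Nrm (Ψ t - Xref) ≤ θ * Nrm Xref
  /-- the start of the path is `(1+θ₀)`-close to the reference direction in the norm `Nrm` -/
  close : Nrm (Γ 0) ≤ (1 + θ₀) * Nrm Xref
  /-- the first variation at `W` against the end velocity exceeds that against the reference by at most `q·Nrm Xref²` -/
  resDev : dAction (cavg L UB) (Ψ 1) (perWin d (N * L ^ k)) ≤ dAction (cavg L UB) Xref (perWin d (N * L ^ k)) + q * Nrm Xref ^ 2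
  /-- a plaquette radius of the moving configuration on the period window -/
  small : ∀ t ∈ Icc (0:ℝ) 1, ∀ p ∈ perWin d (N * L ^ k),
    ‖((fhol (vary (cavg L UB) (Γ t) 1) p : (Matrix n n ℂ)ˣ) : Matrix n n ℂ) - 1‖ ≤ a
  /-- the acceleration bound, against the reference direction -/
  accel : ∀ t ∈ Icc (0:ℝ) 1, a * ∑ p ∈ perWin d (N * L ^ k), ‖curl (vary (cavg L UB) (Γ t) 1) (Ψ' t) p‖
    ≤ κ * Nrm Xref ^ 2

/-- **A `coer`-FREE FIBRE CHART IS AN ENDPOINT CHART** with `Xref := Ψ 1` and `q := 0` (its `adm` at `t = 1` and `endW` give `admW`). [folklore] -/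
theorem endpointChart_of_chartPath {𝒞 : ℕ → Set (Site d → Fin d → (Matrix n n ℂ)ˣ)} {L N k : ℕ}
    {V UA UB : Site d → Fin d → (Matrix n n ℂ)ˣ} {u : Site d → (Matrix n n ℂ)ˣ}
    {Γ Ψ Ψ' : ℝ → Site d → Fin d → Matrix n n ℂ} {T : Set (Site d → Fin d → Matrix n n ℂ)}
    {Nrm : (Site d → Fin d → Matrix n n ℂ) → ℝ} {θ κ θ₀ a : ℝ}
    (h : ChartPath 𝒞 L N k V UA UB u Γ Ψ Ψ' T Nrm θ κ θ₀ a) :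
    EndpointChart 𝒞 L N k V UA UB u Γ Ψ Ψ' (Ψ 1) T Nrm θ κ θ₀ 0 a where
  gauge := h.gauge
  rep := h.rep
  endW := h.endW
  skew := h.skew
  per := h.per
  vel := h.vel
  acc := h.acc
  skewAcc := h.skewAcc
  admW := by
    have h1 := h.adm 1 ⟨zero_le_one, le_rfl⟩
    have hW : vary (cavg L UB) (Γ 1) 1 = cavg L UB := by rw [h.endW]; exact vary_zero_dir _ _
    rw [hW] at h1
    exact h1
  refT := h.tangent
  perT := h.perT
  velocity := h.velocity
  close := h.close
  resDev := by rw [zero_mul, add_zero]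
  small := h.small
  accel := h.accel

/-! ## §2 Minimality at the two ends -/

/-- **MINIMALITY AT THE ENDS**: under an endpoint chart at a pair whose run-A member `U_A` is a minimiser (`L ≥ 1`),
`A(W·e^{Γ 0}) ≤ A(W·e^{Γ 1})` on the period window — `A(W·e^{Γ 0}) = A(U_A^u) = A(U_A)` (`rep`, `fineAction_gaugeAct`),
`W·e^{Γ 1} = W` (`endW`) is admissible (`admW`), and `levelAction = (stepWt⁻¹)^k·fineAction` with a positive weight. [folklore] -/
theorem EndpointChart.end_le {𝒞 : ℕ → Set (Site d → Fin d → (Matrix n n ℂ)ˣ)} {L N k : ℕ} (hL : 1 ≤ L)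
    {V UA UB : Site d → Fin d → (Matrix n n ℂ)ˣ} {u : Site d → (Matrix n n ℂ)ˣ}
    {Γ Ψ Ψ' : ℝ → Site d → Fin d → Matrix n n ℂ} {Xref : Site d → Fin d → Matrix n n ℂ} {T : Set (Site d → Fin d → Matrix n n ℂ)}
    {Nrm : (Site d → Fin d → Matrix n n ℂ) → ℝ} {θ κ θ₀ q a : ℝ}
    (h : EndpointChart 𝒞 L N k V UA UB u Γ Ψ Ψ' Xref T Nrm θ κ θ₀ q a) (hA : IsMinimiser d 𝒞 L N k V UA) :
    (fun s => fineAction (vary (cavg L UB) (Γ s) 1) (perWin d (N * L ^ k))) 0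
      ≤ (fun s => fineAction (vary (cavg L UB) (Γ s) 1) (perWin d (N * L ^ k))) 1 := by
  have hc : 0 < ((stepWt d L)⁻¹) ^ k := pow_pos (inv_pos.mpr (stepWt_pos (d := d) L hL)) k
  have hle := hA.le _ h.admW
  unfold MinimalActionLevels.levelAction at hle
  have hle' := le_of_mul_le_mul_left hle hc
  have hW : vary (cavg L UB) (Γ 1) 1 = cavg L UB := by rw [h.endW]; exact vary_zero_dir _ _
  show fineAction (vary (cavg L UB) (Γ 0) 1) (perWin d (N * L ^ k))
    ≤ fineAction (vary (cavg L UB) (Γ 1) 1) (perWin d (N * L ^ k))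
  rw [← h.rep, fineAction_gaugeAct, hW]
  exact hle'

/-! ## §3 The END in any norm -/

/-- **THE END IN ANY NORM, ENDPOINT FORM.**  For any class family `𝒞`, level `k`, unitary background `W = cavg L U_B` (`hW`), a
non-negative functional `Nrm`, an endpoint chart `h`, a `coer` clause on `T` along the path (`c > 0`), Λ-continuity of the periodised
symmetrised Hessian in `Nrm` (`Λ ≥ 0`), the residual binder at `W` for the REFERENCE direction `Xref` (`r ≥ 0`), `0 ≤ θ₀`, and the budget
`2Λθ + Λθ² + κ + 2q ≤ c∕2`:  **`Nrm (Γ 0) ≤ (1+θ₀)·(4r∕c)`** (`NE3EndpointResponse.energyResponse_of_endpointData_budget` over the C² fields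
of `NE3EnergyPathC2`, the curvature term `abs_e_le` + `accel`, minimality at the ends §2, and `resDev`). [folklore] -/
theorem norm_le_of_endpointChart [Nonempty n] {𝒞 : ℕ → Set (Site d → Fin d → (Matrix n n ℂ)ˣ)} {L N k : ℕ}
    (hL : 1 ≤ L) {V UA UB : Site d → Fin d → (Matrix n n ℂ)ˣ} (hW : IsUnitaryCfg (cavg L UB))
    {u : Site d → (Matrix n n ℂ)ˣ} {Γ Ψ Ψ' : ℝ → Site d → Fin d → Matrix n n ℂ} {Xref : Site d → Fin d → Matrix n n ℂ}
    {T : Set (Site d → Fin d → Matrix n n ℂ)} {Nrm : (Site d → Fin d → Matrix n n ℂ) → ℝ}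
    (hNrm : ∀ Y, 0 ≤ Nrm Y) {c Λ θ κ θ₀ q a r : ℝ}
    (h : EndpointChart 𝒞 L N k V UA UB u Γ Ψ Ψ' Xref T Nrm θ κ θ₀ q a) (hA : IsMinimiser d 𝒞 L N k V UA)
    (hcoer : ∀ t ∈ Icc (0:ℝ) 1, ∀ Y ∈ T, c * Nrm Y ^ 2 ≤ hess (vary (cavg L UB) (Γ t) 1) Y Y (perWin d (N * L ^ k)))
    (hΛ : 0 ≤ Λ) (hθ₀ : 0 ≤ θ₀) (hr : 0 ≤ r) (hc : 0 < c) (hbudget : 2 * Λ * θ + Λ * θ ^ 2 + κ + 2 * q ≤ c / 2)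
    (hcont : ∀ t ∈ Icc (0:ℝ) 1, ∀ Y Z : Site d → Fin d → Matrix n n ℂ,
      |HsPer (vary (cavg L UB) (Γ t) 1) (perWin d (N * L ^ k)) (N * L ^ k) Y Z| ≤ Λ * Nrm Y * Nrm Z)
    (hres : ∀ D : ℝ, HasDerivAt (fun s : ℝ => fineAction (vary (cavg L UB) Xref s) (perWin d (N * L ^ k))) D 0 →
      |D| ≤ r * Nrm Xref) :
    Nrm (Γ 0) ≤ (1 + θ₀) * (4 * r / c) := by
  -- periodicity of the velocities on `[0,1]` and unitarity of the moving configuration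
  have hΨP : ∀ t ∈ Icc (0:ℝ) 1, IsPeriodicDir (Ψ t) ((N * L ^ k : ℕ) : ℤ) :=
    fun t ht => isPeriodicDir_vel h.per (h.vel t ht)
  have hWt : ∀ t, IsUnitaryCfg (vary (cavg L UB) (Γ t) 1) := fun t => vary_isUnitaryCfg hW (h.skew t) 1
  -- the residual at the competitor's end: `φ′ 1 = dAction W (Ψ 1) ≤ dAction W Xref + q·Nrm Xref² ≤ r·Nrm Xref + q·Nrm Xref²`
  have hW1 : vary (cavg L UB) (Γ 1) 1 = cavg L UB := by rw [h.endW]; exact vary_zero_dir _ _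
  have hDref : |dAction (cavg L UB) Xref (perWin d (N * L ^ k))| ≤ r * Nrm Xref := by
    have hD := hasDerivAt_fineAction_vary_at (cavg L UB) Xref (perWin d (N * L ^ k)) 0
    rw [vary_zero] at hD
    exact hres _ hD
  have hres1 : (fun s : ℝ => dAction (vary (cavg L UB) (Γ s) 1) (Ψ s) (perWin d (N * L ^ k))) 1
      ≤ r * Nrm Xref + q * Nrm Xref ^ 2 := by
    show dAction (vary (cavg L UB) (Γ 1) 1) (Ψ 1) (perWin d (N * L ^ k)) ≤ r * Nrm Xref + q * Nrm Xref ^ 2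
    rw [hW1]
    exact h.resDev.trans (by linarith [le_abs_self (dAction (cavg L UB) Xref (perWin d (N * L ^ k)))])
  have hX : Nrm Xref ≤ 4 * r / c :=
    energyResponse_of_endpointData_budget
      (φ := fun s => fineAction (vary (cavg L UB) (Γ s) 1) (perWin d (N * L ^ k)))
      (φ' := fun s => dAction (vary (cavg L UB) (Γ s) 1) (Ψ s) (perWin d (N * L ^ k)))
      (φ'' := fun s => hess (vary (cavg L UB) (Γ s) 1) (Ψ s) (Ψ s) (perWin d (N * L ^ k))
        + dAction (vary (cavg L UB) (Γ s) 1) (Ψ' s) (perWin d (N * L ^ k)))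
      (fun s => HsPer (vary (cavg L UB) (Γ s) 1) (perWin d (N * L ^ k)) (N * L ^ k))
      (fun t _ x y => HsPer_symm _ _ _ x y) Nrm hNrm T hΛ hr hc
      (fun t ht Y hY => by
        simp only [HsPer_self_of_periodic _ _ _ (h.perT Y hY)]
        exact hcoer t ht Y hY)
      hcont h.refT (fun s => Ψ s - Xref) h.velocity
      (fun s => dAction (vary (cavg L UB) (Γ s) 1) (Ψ' s) (perWin d (N * L ^ k)))
      (fun t ht => (abs_e_le (hWt t) (h.skewAcc t ht) _ (h.small t ht)).trans (h.accel t ht))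
      (fun t ht => hasDerivAt_fineAction_gpath (cavg L UB) (h.vel t ht) (perWin d (N * L ^ k)))
      (fun t ht => hasDerivAt_dAction_gpath (cavg L UB) (h.vel t ht) (h.acc t ht) (perWin d (N * L ^ k)))
      (fun t ht => by simp only [add_sub_cancel, HsPer_self_of_periodic _ _ _ (hΨP t ht)])
      (h.end_le hL hA) hres1 hbudget
  calc Nrm (Γ 0) ≤ (1 + θ₀) * Nrm Xref := h.close
    _ ≤ (1 + θ₀) * (4 * r / c) := mul_le_mul_of_nonneg_left hX (by linarith)

/-! ## §4 Changing the norm on periodic directions -/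

/-- Everything an endpoint chart measures in `Nrm` is `(N·L^k)`-periodic (`Ψ t − Xref`, `Xref`, `Γ 0`); so if `Nrm′` agrees with
`Nrm` on periodic directions, an endpoint chart in `Nrm` is one in `Nrm′`. [folklore] -/
theorem EndpointChart.of_eqOn_periodic {𝒞 : ℕ → Set (Site d → Fin d → (Matrix n n ℂ)ˣ)} {L N k : ℕ}
    {V UA UB : Site d → Fin d → (Matrix n n ℂ)ˣ} {u : Site d → (Matrix n n ℂ)ˣ}
    {Γ Ψ Ψ' : ℝ → Site d → Fin d → Matrix n n ℂ} {Xref : Site d → Fin d → Matrix n n ℂ} {T : Set (Site d → Fin d → Matrix n n ℂ)}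
    {Nrm Nrm' : (Site d → Fin d → Matrix n n ℂ) → ℝ} {θ κ θ₀ q a : ℝ}
    (hN : ∀ Y, IsPeriodicDir Y ((N * L ^ k : ℕ) : ℤ) → Nrm' Y = Nrm Y)
    (h : EndpointChart 𝒞 L N k V UA UB u Γ Ψ Ψ' Xref T Nrm θ κ θ₀ q a) :
    EndpointChart 𝒞 L N k V UA UB u Γ Ψ Ψ' Xref T Nrm' θ κ θ₀ q a := by
  have hΨP : ∀ t ∈ Icc (0:ℝ) 1, IsPeriodicDir (Ψ t) ((N * L ^ k : ℕ) : ℤ) :=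
    fun t ht => isPeriodicDir_vel h.per (h.vel t ht)
  have hXP : IsPeriodicDir Xref ((N * L ^ k : ℕ) : ℤ) := h.perT Xref h.refT
  have hdP : ∀ t ∈ Icc (0:ℝ) 1, IsPeriodicDir (Ψ t - Xref) ((N * L ^ k : ℕ) : ℤ) := by
    intro t ht x i μ
    show Ψ t (x + ((N * L ^ k : ℕ) : ℤ) • e i) μ - Xref (x + ((N * L ^ k : ℕ) : ℤ) • e i) μ = Ψ t x μ - Xref x μ
    rw [hΨP t ht x i μ, hXP x i μ]
  exact
    { gauge := h.gauge
      rep := h.rep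
      endW := h.endW
      skew := h.skew
      per := h.per
      vel := h.vel
      acc := h.acc
      skewAcc := h.skewAcc
      admW := h.admW
      refT := h.refT
      perT := h.perT
      velocity := fun t ht => by rw [hN _ (hdP t ht), hN _ hXP]; exact h.velocity t ht
      close := by rw [hN _ (h.per 0), hN _ hXP]; exact h.close
      resDev := by rw [hN _ hXP]; exact h.resDev
      small := h.small
      accel := fun t ht => by rw [hN _ hXP]; exact h.accel t ht }

/-! ## §5 The weighted END at one pair, in the owner's sockets -/

/-- **THE WEIGHTED END AT ONE PAIR, ENDPOINT FORM.**  Level `k`, `1 ≤ L`, `1 ≤ N`, background `W = cavg L U_B` unitary, `F = periodBox (N·L^k)`;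
an endpoint chart `h` in the norm `energyNormW L k W · F` with constants `(θ, κ, θ₀, q)` and plaquette radius `a ≥ 0`; a `coer` clause on `T`
along the path with constant `c > 0`; sup-radius `α ≥ 0` of the path; `(1 + 24√d·(e^α − 1)·L^k)² + 48·d·a·(L^k)² ≤ Λ`; (RES♯)
`CurlPairedResidual L k W T r F`; `U_A` a minimiser; `0 ≤ θ₀`, `0 ≤ r`; budget `2Λθ + Λθ² + κ + 2q ≤ c∕2`.  THEN
**`energyNormW L k W (Γ 0) F ≤ (1+θ₀)·(4r∕c)`**. [folklore] -/
theorem energyNormW_le_of_endpointChart [Nonempty n] {𝒞 : ℕ → Set (Site d → Fin d → (Matrix n n ℂ)ˣ)} {L N k : ℕ}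
    (hL : 1 ≤ L) (hN : 1 ≤ N) {V UA UB : Site d → Fin d → (Matrix n n ℂ)ˣ} (hW : IsUnitaryCfg (cavg L UB))
    {u : Site d → (Matrix n n ℂ)ˣ} {Γ Ψ Ψ' : ℝ → Site d → Fin d → Matrix n n ℂ} {Xref : Site d → Fin d → Matrix n n ℂ}
    {T : Set (Site d → Fin d → Matrix n n ℂ)} {c Λ θ κ θ₀ q a r α : ℝ} (hα : 0 ≤ α) (ha0 : 0 ≤ a)
    (h : EndpointChart 𝒞 L N k V UA UB u Γ Ψ Ψ' Xref T
      (fun Y => energyNormW L k (cavg L UB) Y (periodBox (N * L ^ k))) θ κ θ₀ q a)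
    (hcoer : ∀ t ∈ Icc (0:ℝ) 1, ∀ Y ∈ T,
      c * energyNormW L k (cavg L UB) Y (periodBox (N * L ^ k)) ^ 2 ≤ hess (vary (cavg L UB) (Γ t) 1) Y Y (perWin d (N * L ^ k)))
    (hΓα : ∀ t (x : Site d) (μ : Fin d), ‖Γ t x μ‖ ≤ α)
    (hΛw : (1 + 24 * Real.sqrt d * (Real.exp α - 1) * (L : ℝ) ^ k) ^ 2 + 48 * d * a * ((L : ℝ) ^ k) ^ 2 ≤ Λ)
    (hres : CurlPairedResidual L k (cavg L UB) T r (periodBox (N * L ^ k)))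
    (hA : IsMinimiser d 𝒞 L N k V UA) (hθ₀ : 0 ≤ θ₀) (hr : 0 ≤ r) (hc : 0 < c)
    (hbudget : 2 * Λ * θ + Λ * θ ^ 2 + κ + 2 * q ≤ c / 2) :
    energyNormW L k (cavg L UB) (Γ 0) (periodBox (N * L ^ k)) ≤ (1 + θ₀) * (4 * r / c) := by
  have hL0 : (0 : ℝ) < L := by exact_mod_cast hL
  have hs : (0 : ℝ) < (L : ℝ) ^ k := pow_pos hL0 k
  have hP : 1 ≤ N * L ^ k := Nat.mul_pos (by omega) (Nat.pow_pos (by omega))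
  -- the weighted norm read through the periodic extension agrees with `energyNormW` on periodic directions
  have hNe : ∀ Y : Site d → Fin d → Matrix n n ℂ, IsPeriodicDir Y ((N * L ^ k : ℕ) : ℤ) →
      Real.sqrt (curlSq (cavg L UB) (perExt (N * L ^ k) Y) (periodBox (N * L ^ k))
        + dirSq (perExt (N * L ^ k) Y) (periodBox (N * L ^ k)) / ((L : ℝ) ^ k) ^ 2)
      = (fun Y => energyNormW L k (cavg L UB) Y (periodBox (N * L ^ k))) Y := by
    intro Y hY
    show _ = energyNormW L k (cavg L UB) Y (periodBox (N * L ^ k))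
    rw [perExt_eq_of_periodic _ hY, energyNormW_eq_sqrt_div]
  have h' := EndpointChart.of_eqOn_periodic
    (Nrm' := fun Y => Real.sqrt (curlSq (cavg L UB) (perExt (N * L ^ k) Y) (periodBox (N * L ^ k))
      + dirSq (perExt (N * L ^ k) Y) (periodBox (N * L ^ k)) / ((L : ℝ) ^ k) ^ 2)) hNe h
  have hXP : IsPeriodicDir Xref ((N * L ^ k : ℕ) : ℤ) := h.perT Xref h.refT
  have hΛw0 : (0 : ℝ) ≤ (1 + 24 * Real.sqrt d * (Real.exp α - 1) * (L : ℝ) ^ k) ^ 2 + 48 * d * a * ((L : ℝ) ^ k) ^ 2 := by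
    positivity
  have hΛ : 0 ≤ Λ := hΛw0.trans hΛw
  -- the continuity clause with the dominating constant `Λ`
  have hcont : ∀ t ∈ Icc (0:ℝ) 1, ∀ Y Z : Site d → Fin d → Matrix n n ℂ,
      |HsPer (vary (cavg L UB) (Γ t) 1) (perWin d (N * L ^ k)) (N * L ^ k) Y Z|
        ≤ Λ * (fun Y => Real.sqrt (curlSq (cavg L UB) (perExt (N * L ^ k) Y) (periodBox (N * L ^ k))
              + dirSq (perExt (N * L ^ k) Y) (periodBox (N * L ^ k)) / ((L : ℝ) ^ k) ^ 2)) Y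
            * (fun Y => Real.sqrt (curlSq (cavg L UB) (perExt (N * L ^ k) Y) (periodBox (N * L ^ k))
              + dirSq (perExt (N * L ^ k) Y) (periodBox (N * L ^ k)) / ((L : ℝ) ^ k) ^ 2)) Z := by
    intro t ht Y Z
    have hc0 := cont_weighted hW h.skew hα hΓα hP ha0 h.small hs t ht Y Z
    have hY0 := Real.sqrt_nonneg (curlSq (cavg L UB) (perExt (N * L ^ k) Y) (periodBox (N * L ^ k))
      + dirSq (perExt (N * L ^ k) Y) (periodBox (N * L ^ k)) / ((L : ℝ) ^ k) ^ 2)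
    have hZ0 := Real.sqrt_nonneg (curlSq (cavg L UB) (perExt (N * L ^ k) Z) (periodBox (N * L ^ k))
      + dirSq (perExt (N * L ^ k) Z) (periodBox (N * L ^ k)) / ((L : ℝ) ^ k) ^ 2)
    refine hc0.trans ?_
    have := mul_le_mul_of_nonneg_right (mul_le_mul_of_nonneg_right hΛw hY0) hZ0
    simpa only [mul_assoc] using this
  -- the `coer` clause in the extended norm (agrees on the periodic members of `T`)
  have hcoer' : ∀ t ∈ Icc (0:ℝ) 1, ∀ Y ∈ T,
      c * (fun Y => Real.sqrt (curlSq (cavg L UB) (perExt (N * L ^ k) Y) (periodBox (N * L ^ k))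
              + dirSq (perExt (N * L ^ k) Y) (periodBox (N * L ^ k)) / ((L : ℝ) ^ k) ^ 2)) Y ^ 2
        ≤ hess (vary (cavg L UB) (Γ t) 1) Y Y (perWin d (N * L ^ k)) := by
    intro t ht Y hY
    beta_reduce
    rw [hNe _ (h.perT Y hY)]
    exact hcoer t ht Y hY
  -- the residual binder in the extended norm, for the reference direction
  have hres' : ∀ D : ℝ, HasDerivAt (fun σ : ℝ => fineAction (vary (cavg L UB) Xref σ) (perWin d (N * L ^ k))) D 0 →
      |D| ≤ r * Real.sqrt (curlSq (cavg L UB) (perExt (N * L ^ k) Xref) (periodBox (N * L ^ k))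
        + dirSq (perExt (N * L ^ k) Xref) (periodBox (N * L ^ k)) / ((L : ℝ) ^ k) ^ 2) := by
    intro D hD
    rw [hNe _ hXP]
    exact res_of_curlPairedResidual hres h.refT D hD
  have hend := norm_le_of_endpointChart hL hW (fun Y => Real.sqrt_nonneg _) h' hA hcoer' hΛ hθ₀ hr hc hbudget hcont hres'
  rw [hNe _ (h.per 0)] at hend
  exact hend

end

end Summit.QuantumFields.BalabanUV.T4Continuum.NE3EndpointChart
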